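import Mathlib
import HarnessLib
import Summits.KontsevichZagierPeriods.Zeta5Search.NestedQSecondRecursion
import Summits.KontsevichZagierPeriods.Zeta5Search.SorokinConvergence
import Literature.Analysis.SpecialFunctions.HypergeometricEulerIntegral

/-!
# ζ(5) search — Zudilin's `J_k` at complex parameters: the last integration is an Euler integral (cell `pub-zeta5`, ct-1 g27)

HONEST FRAMING: systematic search; no irrationality claim unless kernel-certified.  An identity of integrals (Fubini) and a
convergence statement; nothing here is an irrationality result, a worthiness exponent or a denominator statement; no named
fact is discharged; NO definition is introduced (the complex-parameter integrand is written inline).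

First half of brick B3 (Zudilin math/0206177, Lemma 3) of `HOME/ct-1/g26/VWP-BLUEPRINT.md`.  For COMPLEX parameters `a₀`, `a_j`,
`b_j` the integrand of `J_{k+1}` on `[0,1]^{k+1}` is (principal powers of the real coordinates cast into `ℂ`)

  `F(x) = ∏_{j ≤ k} x_j^{a_j−1}(1−x_j)^{b_j−a_j−1} · Q_{k+1}(x)^{−a₀}`.

Splitting off the LAST variable `t = x_k` (`x = Fin.snoc x' t`) and using the factorisation
`Q_{k+1}(x',t) = Q_k(x')(1 − z t)`, `z = (−1)^k ∏ x'_j / Q_k(x')` (`NestedQSecondRecursion.cpow_nestedQ_snoc`), the inner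
`t`-integral is the tree's Euler integral `Hypergeometric.eulerIntegral a₀ a_k b_k z = ∫₀¹ t^{a_k−1}(1−t)^{b_k−a_k−1}(1−zt)^{−a₀} dt`:

* `norm_integrand` — on the open cube `‖F(x)‖` is the TYPED real integrand `sorokinIntegrand` at the real parts;
* `integrableOn_integrand` — hence `F` is integrable on `[0,1]^{k+1}` under the corner conditions of
  `SorokinConvergence.integrableOn_sorokinIntegrand` on the real parts;
* `setIntegral_succ_eq` — **for `k ≥ 1` and `F` integrable:
  `∫_{[0,1]^{k+1}} F = ∫_{[0,1]^k} ∏_{j<k} x'_j^{a_j−1}(1−x'_j)^{b_j−a_j−1} · Q_k(x')^{−a₀} · eulerIntegral a₀ a_k b_k (z(x')) dx'`**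
  (`volume_preserving_piFinSuccAbove` at `Fin.last k`, Fubini `integral_prod_symm`).

Lemma 3 itself (replace the Euler integral by the Barnes integral of `BarnesEulerIntegral` / `BarnesEulerIntegralCut` according to the
sign of `z`, `NestedQSecondRecursion.z_sign`, and swap the `x'`- and line-integrals) is the successor's step.  Theorems only.
-/

noncomputable section

namespace Summit.KontsevichZagierPeriods.Zeta5Search.SorokinLastVariable

open MeasureTheory Set Filter
open Literature.NumberTheory.Irrationality.Zudilin2002 (nestedQ sorokinIntegrand)
open Literature.Analysis.SpecialFunctions.Hypergeometric (eulerIntegrand eulerIntegral)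
open Summit.KontsevichZagierPeriods.Zeta5Search.SorokinIntegrandBounds
open Summit.KontsevichZagierPeriods.Zeta5Search.NestedQSecondRecursion
open Summit.KontsevichZagierPeriods.Zeta5Search.SorokinConvergence

/-! ### 1. The complex-parameter integrand: norm and integrability -/

/-- On the open cube the norm of the complex-parameter integrand is the typed real integrand at the real parts. -/
theorem norm_integrand (k : ℕ) (a₀ : ℂ) (a b : ℕ → ℂ) {x : Fin k → ℝ} (hx : ∀ j, x j ∈ Ioo (0 : ℝ) 1) :
    ‖(∏ j : Fin k, ((x j : ℝ) : ℂ) ^ (a j - 1) * (1 - ((x j : ℝ) : ℂ)) ^ (b j - a j - 1)) *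
        ((nestedQ (List.ofFn x) : ℝ) : ℂ) ^ (-a₀)‖ =
      sorokinIntegrand k a₀.re (fun n => (a n).re) (fun n => (b n).re) x := by
  have hxc : ∀ j, x j ∈ Icc (0 : ℝ) 1 := fun j => Ioo_subset_Icc_self (hx j)
  have hQ : 0 ≤ nestedQ (List.ofFn x) := (nestedQ_ofFn_mem_Icc hxc).1
  rw [sorokinIntegrand, norm_mul, norm_prod, div_eq_mul_inv, ← Real.rpow_neg hQ]
  congr 1
  · refine Finset.prod_congr rfl fun j _ => ?_
    have h0 : 0 < x j := (hx j).1
    have h1 : 0 < 1 - x j := by linarith [(hx j).2]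
    rw [norm_mul, Complex.norm_cpow_eq_rpow_re_of_pos h0,
      show (1 : ℂ) - ((x j : ℝ) : ℂ) = ((1 - x j : ℝ) : ℂ) by push_cast; ring, Complex.norm_cpow_eq_rpow_re_of_pos h1]
    simp
  · rcases hQ.eq_or_lt with h | h
    · -- cannot happen on the open cube for `k ≥ 1`, and for `k = 0` the kernel is `1`; treat uniformly via the value
      rcases Nat.eq_zero_or_pos k with rfl | hk
      · simp [nestedQ] at h
      · exact absurd h.symm (nestedQ_ofFn_mem_Ioo hk hx).1.ne'
    · rw [Complex.norm_cpow_eq_rpow_re_of_pos h]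
      simp

/-- Measurability of the complex-parameter integrand. -/
theorem measurable_integrand (k : ℕ) (a₀ : ℂ) (a b : ℕ → ℂ) :
    Measurable fun x : Fin k → ℝ =>
      (∏ j : Fin k, ((x j : ℝ) : ℂ) ^ (a j - 1) * (1 - ((x j : ℝ) : ℂ)) ^ (b j - a j - 1)) *
        ((nestedQ (List.ofFn x) : ℝ) : ℂ) ^ (-a₀) := by
  have hQ := (Complex.measurable_ofReal.comp (continuous_nestedQ_ofFn k).measurable).pow_const (-a₀)
  refine Measurable.mul (Finset.measurable_prod _ fun j _ => ?_) hQ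
  have hj : Measurable fun x : Fin k → ℝ => ((x j : ℝ) : ℂ) := Complex.measurable_ofReal.comp (measurable_pi_apply j)
  exact (hj.pow_const _).mul ((measurable_const.sub hj).pow_const _)

/-- **Integrability at complex parameters**: under the corner conditions of `SorokinConvergence.integrableOn_sorokinIntegrand`
on the REAL PARTS, the complex-parameter integrand is integrable on the closed cube `[0,1]^k` (`k ≥ 1`). -/
theorem integrableOn_integrand {k : ℕ} (hk : 1 ≤ k) {a₀ : ℂ} (ha₀ : 0 ≤ a₀.re) {a b : ℕ → ℂ}
    (hE : ∀ j, j < k → 0 < (a j).re ∧ (a j).re < (b j).re)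
    (hA : ∀ i, 2 * i + 2 ≤ k → a₀.re < (∑ m ∈ Finset.range (i + 1), ((b (2 * m)).re - (a (2 * m)).re)) + (a (2 * i + 1)).re)
    (hAodd : Odd k → a₀.re < ∑ m ∈ Finset.range ((k + 1) / 2), ((b (2 * m)).re - (a (2 * m)).re)) :
    IntegrableOn (fun x : Fin k → ℝ =>
      (∏ j : Fin k, ((x j : ℝ) : ℂ) ^ (a j - 1) * (1 - ((x j : ℝ) : ℂ)) ^ (b j - a j - 1)) *
        ((nestedQ (List.ofFn x) : ℝ) : ℂ) ^ (-a₀)) (Set.pi univ fun _ : Fin k => Icc (0 : ℝ) 1) volume := by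
  have hreal := integrableOn_sorokinIntegrand hk ha₀ (a := fun n => (a n).re) (b := fun n => (b n).re) hE hA hAodd
  have hae : (Set.pi univ fun _ : Fin k => Icc (0 : ℝ) 1) =ᵐ[volume] (Set.pi univ fun _ : Fin k => Ioo (0 : ℝ) 1) := by
    rw [volume_pi]; exact Measure.pi_Ioo_ae_eq_pi_Icc.symm
  rw [IntegrableOn, Measure.restrict_congr_set hae] at hreal ⊢
  refine hreal.mono' (measurable_integrand k a₀ a b).aestronglyMeasurable ?_
  filter_upwards [ae_restrict_mem (MeasurableSet.univ_pi fun _ => measurableSet_Ioo)] with x hx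
  exact (norm_integrand k a₀ a b fun j => hx j (mem_univ _)).le

/-! ### 2. Splitting off the last variable -/

/-- The closed cube `[0,1]^{k+1}` is the preimage of `[0,1] × [0,1]^k` under `x ↦ (x_k, (x_0,…,x_{k−1}))`. -/
theorem cube_eq_preimage (k : ℕ) :
    (Set.pi univ fun _ : Fin (k + 1) => Icc (0 : ℝ) 1) =
      MeasurableEquiv.piFinSuccAbove (fun _ => ℝ) (Fin.last k) ⁻¹'
        (Icc (0 : ℝ) 1 ×ˢ Set.pi univ fun _ : Fin k => Icc (0 : ℝ) 1) := by
  ext x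
  simp only [Set.mem_preimage, Set.mem_prod, Set.mem_univ_pi]
  rw [Fin.forall_fin_succ']
  simp [MeasurableEquiv.piFinSuccAbove_apply, Fin.init, and_comm]

/-- The inverse of that equivalence is `Fin.snoc`. -/
theorem piFinSuccAbove_last_symm (k : ℕ) (t : ℝ) (x' : Fin k → ℝ) :
    (MeasurableEquiv.piFinSuccAbove (fun _ => ℝ) (Fin.last k)).symm (t, x') = Fin.snoc x' t := by
  simp [MeasurableEquiv.piFinSuccAbove_symm_apply]; rfl

/-- **Pointwise, on a fibre**: for `x'` in the open cube (`k ≥ 1`) and `t ∈ [0,1]`, the integrand of `J_{k+1}` at `Fin.snoc x' t`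
is `[∏_{j<k} x'_j^{a_j−1}(1−x'_j)^{b_j−a_j−1} · Q_k(x')^{−a₀}] · t^{a_k−1}(1−t)^{b_k−a_k−1}(1 − z t)^{−a₀}`, i.e. that constant times
the tree's `eulerIntegrand a₀ a_k b_k z t`, `z = (−1)^k ∏ x'_j / Q_k(x')`. -/
theorem integrand_snoc {k : ℕ} (hk : 1 ≤ k) (a₀ : ℂ) (a b : ℕ → ℂ) {x' : Fin k → ℝ} (hx' : ∀ j, x' j ∈ Ioo (0 : ℝ) 1)
    {t : ℝ} (ht : t ∈ Icc (0 : ℝ) 1) :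
    (∏ j : Fin (k + 1), (((Fin.snoc x' t : Fin (k + 1) → ℝ) j : ℝ) : ℂ) ^ (a j - 1) *
          (1 - (((Fin.snoc x' t : Fin (k + 1) → ℝ) j : ℝ) : ℂ)) ^ (b j - a j - 1)) *
        ((nestedQ (List.ofFn (Fin.snoc x' t : Fin (k + 1) → ℝ)) : ℝ) : ℂ) ^ (-a₀) =
      ((∏ j : Fin k, ((x' j : ℝ) : ℂ) ^ (a j - 1) * (1 - ((x' j : ℝ) : ℂ)) ^ (b j - a j - 1)) *
          ((nestedQ (List.ofFn x') : ℝ) : ℂ) ^ (-a₀)) *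
        eulerIntegrand a₀ (a k) (b k) ((((-1) ^ k * (∏ j, x' j) / nestedQ (List.ofFn x') : ℝ)) : ℂ) t := by
  rw [Fin.prod_univ_castSucc, cpow_nestedQ_snoc hk hx' ht (-a₀), eulerIntegrand]
  simp only [Fin.snoc_castSucc, Fin.snoc_last, Fin.val_castSucc, Fin.val_last]
  push_cast
  ring

/-- **`J_{k+1}` as a `k`-fold integral of an Euler integral** (first half of Zudilin's Lemma 3, complex parameters, `k ≥ 1`):
if the integrand `F` of `J_{k+1}(a₀; a_0..a_k | b_0..b_k)` is integrable on `[0,1]^{k+1}`, then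
`∫_{[0,1]^{k+1}} F = ∫_{[0,1]^k} ∏_{j<k} x'_j^{a_j−1}(1−x'_j)^{b_j−a_j−1} · Q_k(x')^{−a₀} · eulerIntegral a₀ a_k b_k ((−1)^k ∏x'_j/Q_k(x')) dx'`
(transfer along `x ↦ (x_k, x')`, Fubini, `integrand_snoc`; the Euler integral is the tree's `∫₀¹ t^{a_k−1}(1−t)^{b_k−a_k−1}(1−zt)^{−a₀}dt`). -/
theorem setIntegral_succ_eq {k : ℕ} (hk : 1 ≤ k) (a₀ : ℂ) (a b : ℕ → ℂ)
    (hF : IntegrableOn (fun x : Fin (k + 1) → ℝ =>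
      (∏ j : Fin (k + 1), ((x j : ℝ) : ℂ) ^ (a j - 1) * (1 - ((x j : ℝ) : ℂ)) ^ (b j - a j - 1)) *
        ((nestedQ (List.ofFn x) : ℝ) : ℂ) ^ (-a₀)) (Set.pi univ fun _ : Fin (k + 1) => Icc (0 : ℝ) 1) volume) :
    ∫ x in Set.pi univ (fun _ : Fin (k + 1) => Icc (0 : ℝ) 1),
        (∏ j : Fin (k + 1), ((x j : ℝ) : ℂ) ^ (a j - 1) * (1 - ((x j : ℝ) : ℂ)) ^ (b j - a j - 1)) *
          ((nestedQ (List.ofFn x) : ℝ) : ℂ) ^ (-a₀) =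
      ∫ x' in Set.pi univ (fun _ : Fin k => Icc (0 : ℝ) 1),
        ((∏ j : Fin k, ((x' j : ℝ) : ℂ) ^ (a j - 1) * (1 - ((x' j : ℝ) : ℂ)) ^ (b j - a j - 1)) *
            ((nestedQ (List.ofFn x') : ℝ) : ℂ) ^ (-a₀)) *
          eulerIntegral a₀ (a k) (b k) ((((-1) ^ k * (∏ j, x' j) / nestedQ (List.ofFn x') : ℝ)) : ℂ) := by
  set F : (Fin (k + 1) → ℝ) → ℂ := fun x =>
    (∏ j : Fin (k + 1), ((x j : ℝ) : ℂ) ^ (a j - 1) * (1 - ((x j : ℝ) : ℂ)) ^ (b j - a j - 1)) *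
      ((nestedQ (List.ofFn x) : ℝ) : ℂ) ^ (-a₀) with hFdef
  set e := MeasurableEquiv.piFinSuccAbove (fun _ : Fin (k + 1) => ℝ) (Fin.last k) with hedef
  set S : Set (ℝ × (Fin k → ℝ)) := Icc (0 : ℝ) 1 ×ˢ Set.pi univ fun _ : Fin k => Icc (0 : ℝ) 1 with hSdef
  set G : ℝ × (Fin k → ℝ) → ℂ := fun p => F (e.symm p) with hGdef
  have hmp : MeasurePreserving e volume volume := volume_preserving_piFinSuccAbove (fun _ : Fin (k + 1) => ℝ) (Fin.last k)
  have hcube := cube_eq_preimage k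
  -- (1) transfer the integral and the integrability along `e`
  have key := hmp.setIntegral_preimage_emb e.measurableEmbedding G S
  have hGe : (fun x => G (e x)) = F := by funext x; simp [hGdef]
  rw [hGe, ← hcube] at key
  change ∫ x in Set.pi univ (fun _ : Fin (k + 1) => Icc (0 : ℝ) 1), F x = _
  rw [key]
  have hGint : Integrable G ((volume : Measure (ℝ × (Fin k → ℝ))).restrict S) := by
    have h := (hmp.restrict_preimage_emb e.measurableEmbedding S).integrable_comp_emb e.measurableEmbedding (g := G)
    rw [← hcube] at h
    have hGF : G ∘ e = F := by funext x; simp [hGdef]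
    rw [hGF] at h
    exact h.1 hF
  rw [Measure.volume_eq_prod, ← Measure.prod_restrict] at hGint ⊢
  -- (2) Fubini, integrating over `t` first
  rw [integral_prod_symm G hGint]
  -- (3) the fibre integrals, for a.e. `x'` (the open cube)
  have hae : (Set.pi univ fun _ : Fin k => Icc (0 : ℝ) 1) =ᵐ[volume] (Set.pi univ fun _ : Fin k => Ioo (0 : ℝ) 1) := by
    rw [volume_pi]; exact Measure.pi_Ioo_ae_eq_pi_Icc.symm
  have hopen : ∀ᵐ x' ∂((volume : Measure (Fin k → ℝ)).restrict (Set.pi univ fun _ : Fin k => Icc (0 : ℝ) 1)),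
      ∀ j, x' j ∈ Ioo (0 : ℝ) 1 := by
    rw [Measure.restrict_congr_set hae]
    filter_upwards [ae_restrict_mem (MeasurableSet.univ_pi fun _ => measurableSet_Ioo)] with x hx
    exact fun j => hx j (mem_univ _)
  refine integral_congr_ae ?_
  filter_upwards [hopen] with x' hx'
  have hGx : (fun t => G (t, x')) = fun t => F (Fin.snoc x' t) := by
    funext t; rw [hGdef]; simp only [hedef, piFinSuccAbove_last_symm]
  rw [hGx]
  -- the `t`-integrand on `[0,1]`
  have hpt : ∀ t ∈ Icc (0 : ℝ) 1, F (Fin.snoc x' t) =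
      ((∏ j : Fin k, ((x' j : ℝ) : ℂ) ^ (a j - 1) * (1 - ((x' j : ℝ) : ℂ)) ^ (b j - a j - 1)) *
          ((nestedQ (List.ofFn x') : ℝ) : ℂ) ^ (-a₀)) *
        eulerIntegrand a₀ (a k) (b k) ((((-1) ^ k * (∏ j, x' j) / nestedQ (List.ofFn x') : ℝ)) : ℂ) t := fun t ht => by
    rw [hFdef]
    exact integrand_snoc hk a₀ a b hx' ht
  rw [setIntegral_congr_fun measurableSet_Icc hpt, integral_const_mul, eulerIntegral,
    intervalIntegral.integral_of_le zero_le_one, integral_Icc_eq_integral_Ioc]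

/-- **Corollary** (hypotheses on the real parts instead of integrability): for `k ≥ 1`, `Re a₀ ≥ 0`, `0 < Re a_j < Re b_j`
(`j ≤ k`) and the corner conditions of `J_{k+1}` on the real parts, the identity of `setIntegral_succ_eq` holds. -/
theorem setIntegral_succ_eq_of_re {k : ℕ} (hk : 1 ≤ k) {a₀ : ℂ} (ha₀ : 0 ≤ a₀.re) {a b : ℕ → ℂ}
    (hE : ∀ j, j < k + 1 → 0 < (a j).re ∧ (a j).re < (b j).re)
    (hA : ∀ i, 2 * i + 2 ≤ k + 1 → a₀.re < (∑ m ∈ Finset.range (i + 1), ((b (2 * m)).re - (a (2 * m)).re)) + (a (2 * i + 1)).re)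
    (hAodd : Odd (k + 1) → a₀.re < ∑ m ∈ Finset.range ((k + 2) / 2), ((b (2 * m)).re - (a (2 * m)).re)) :
    ∫ x in Set.pi univ (fun _ : Fin (k + 1) => Icc (0 : ℝ) 1),
        (∏ j : Fin (k + 1), ((x j : ℝ) : ℂ) ^ (a j - 1) * (1 - ((x j : ℝ) : ℂ)) ^ (b j - a j - 1)) *
          ((nestedQ (List.ofFn x) : ℝ) : ℂ) ^ (-a₀) =
      ∫ x' in Set.pi univ (fun _ : Fin k => Icc (0 : ℝ) 1),
        ((∏ j : Fin k, ((x' j : ℝ) : ℂ) ^ (a j - 1) * (1 - ((x' j : ℝ) : ℂ)) ^ (b j - a j - 1)) *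
            ((nestedQ (List.ofFn x') : ℝ) : ℂ) ^ (-a₀)) *
          eulerIntegral a₀ (a k) (b k) ((((-1) ^ k * (∏ j, x' j) / nestedQ (List.ofFn x') : ℝ)) : ℂ) :=
  setIntegral_succ_eq hk a₀ a b (integrableOn_integrand (by omega) ha₀ hE hA hAodd)

end Summit.KontsevichZagierPeriods.Zeta5Search.SorokinLastVariable

end
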